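import Summits.RiemannHypothesis.RiemannHypothesis.Theses.WeilPos
import Summits.RiemannHypothesis.RiemannHypothesis.Theorems.WeilPosWeilposSlackRungLog2
import HarnessLib

/-!
# `WeilPos.SlackRungLog2OfSlackThesis` (item stmt-RiemannHypothesis-18200) — glue closer

`WeilposSlackThesis → WeilposSlackRungLog2`: the conclusion is item stmt-RiemannHypothesis-18182, CLOSED in the
tree by `Theorems.WeilposSlackRungLog2_proof`, so the implication holds with the hypothesis unused.
Cell rh-split (typer-3 g3 glue sweep, RULING #374).  Pure propositional glue; no analysis.
Nothing here bears on the truth of RH.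
-/

set_option linter.dupNamespace false  -- the mandated namespace repeats `RiemannHypothesis`

namespace Summit.RiemannHypothesis.RiemannHypothesis.Theorems.WeilPos

/-- **`SlackRungLog2OfSlackThesis` (item stmt-RiemannHypothesis-18200) holds**: its conclusion
`WeilposSlackRungLog2` is already a tree theorem (`Theorems.WeilposSlackRungLog2_proof`). [folklore] -/
theorem slackRungLog2OfSlackThesis_proof : Summit.RiemannHypothesis.RiemannHypothesis.Theses.WeilPos.SlackRungLog2OfSlackThesis :=
  fun _ => Summit.RiemannHypothesis.RiemannHypothesis.Theorems.WeilposSlackRungLog2_proof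

end Summit.RiemannHypothesis.RiemannHypothesis.Theorems.WeilPos
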